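import Literature.NumberTheory.LFunctions.MoebiusAutomaticTransducerReduction
import Literature.NumberTheory.LFunctions.AutomaticSequenceTransducerRelabel
import HarnessLib

/-!
# The transducer estimate is invariant under relabelling (Müllner 2017, Prop. 2.6 with Prop. 3.2; proved)

Everything in this file is PROVED (plus one plain definition). The hypothesis of the reduction
`mullner_moebius_automatic_of_transducerEstimate` (`MoebiusAutomaticTransducerReduction.lean`) is
the estimate `TransducerMoebiusEstimateSync` for the outputs `MinImage.T` read through the
ARBITRARY enumerations `MinImage.enum`. Müllner proves Prop. 3.2 for a naturally induced transducer
with well-chosen orderings (Lemma 2.14: all outputs in one group `G`, Thm. 2.7); Prop. 2.6 says a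
reordering conjugates the outputs. Here we make this bookkeeping available:

* `TransducerMoebiusEstimateSyncρ k δ ρ M π λ₁ λ₂` — the same estimate for the relabelled outputs
  `MinImage.Tρ ρ` (`AutomaticSequenceTransducerRelabel.lean`);
* `Tρ_msbBlock_eq_iff` — on a synchronized residue class the transducer state after the suffix is
  fixed (`MinImage.next_msbBlock_eq_of_sync`), so `T̄ = π' ↔ T = ρ_M ≫ π' ≫ ρ_S⁻¹`: the relabelled
  and the original indicator conditions select THE SAME integers `n`;
* `TransducerMoebiusEstimateSync.relabel`, `TransducerMoebiusEstimateSyncρ.unlabel` — hence the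
  estimate for all `π` in one labelling is equivalent to the estimate for all `π'` in any other;
* `mullner_moebius_automatic_of_transducerEstimateρ` — the reduction Prop. 3.3 with the hypothesis
  in the form a future proof of Prop. 3.2 will produce: for every strongly connected base-`k`
  automaton SOME relabelling (e.g. `MinImage.goodLabel`, Lemma 2.14) satisfies the estimate.

## References
* C. Müllner, Duke Math. J. 166 (2017), Prop. 2.6, Lemma 2.14, Prop. 3.2, Prop. 3.3. [Mullner2017]
-/

noncomputable section

open Finset Filter Asymptotics
open scoped ArithmeticFunction.Moebius

namespace Literature.NumberTheory.LFunctions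

section Transfer

variable {σ' : Type*} [Fintype σ'] [DecidableEq σ']

/-- **Prop. 3.2 (synchronized residues) for a relabelled transducer**: the estimate
`TransducerMoebiusEstimateSync` with `MinImage.Tρ ρ` in place of `MinImage.T`. A property with
parameters, not asserted. [cite: Mullner2017, Prop. 3.2] -/
def TransducerMoebiusEstimateSyncρ (k : ℕ) (δ' : σ' → ℕ → σ')
    (ρ : MinImage δ' → Equiv.Perm (Fin (minRank δ'))) (M : MinImage δ')
    (π : Equiv.Perm (Fin (minRank δ'))) (l1 l2 : ℕ) : Prop :=
  ∀ ε : ℝ, 0 < ε → ∃ N₀ : ℕ, ∀ N : ℕ, N₀ ≤ N → ∀ b m : ℕ,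
    (∃ w₀ : List ℕ, (fullImage δ' w₀).card = minRank δ' ∧ w₀ <:+: msbBlock k l2 m) →
    ‖∑ n ∈ (Finset.range (N + 1)).filter (fun n =>
        n / k ^ ((Nat.digits k N).length - l1) = b ∧ n % k ^ l2 = m ∧
          M.Tρ ρ (msbBlock k ((Nat.digits k N).length - l1)
            (n % k ^ ((Nat.digits k N).length - l1))) = π),
      (μ n : ℂ)‖ ≤ ε * N

/-- **Relabelled and original conditions select the same integers** (Prop. 2.6 on a synchronized
residue class): with `S = δ(M, w₀ (m)_k^{λ₂})` the state after any synchronized suffix,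
`T̄(M, x) = π' ↔ T(M, x) = ρ_M ≫ π' ≫ ρ_S⁻¹` for the suffix `x = (n mod k^L)_k^L` of every
`n ≡ m (k^{λ₂})`, `L ≥ λ₂`. [cite: Mullner2017, Prop. 2.6] -/
theorem Tρ_msbBlock_eq_iff {k : ℕ} (hk : 1 < k) {δ' : σ' → ℕ → σ'}
    (ρ : MinImage δ' → Equiv.Perm (Fin (minRank δ'))) (M : MinImage δ') {w₀ : List ℕ}
    (hw₀ : (fullImage δ' w₀).card = minRank δ') {l2 m : ℕ} (hm : w₀ <:+: msbBlock k l2 m)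
    {n : ℕ} (hn : n % k ^ l2 = m) {L : ℕ} (hL : l2 ≤ L) (π' : Equiv.Perm (Fin (minRank δ'))) :
    M.Tρ ρ (msbBlock k L (n % k ^ L)) = π' ↔
      M.T (msbBlock k L (n % k ^ L)) =
        ((ρ M).trans π').trans (ρ (M.next (w₀ ++ msbBlock k l2 m))).symm := by
  rw [MinImage.Tρ, MinImage.next_msbBlock_eq_of_sync hk M hw₀ hm hn hL]
  constructor
  · intro h
    rw [← h]
    ext i
    simp
  · intro h
    rw [h]
    ext i
    simp

/-- The number of base-`k` digits of `N ≥ k^{λ₁+λ₂}` is at least `λ₁ + λ₂`. [folklore] -/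
theorem le_length_digits_sub {k l1 l2 N : ℕ} (hk : 1 < k) (hN : k ^ (l1 + l2) ≤ N) :
    l2 ≤ (Nat.digits k N).length - l1 := by
  have hNν : N < k ^ (Nat.digits k N).length := Nat.lt_base_pow_length_digits hk
  have := ((Nat.pow_lt_pow_iff_right hk).1 (lt_of_le_of_lt hN hNν)).le
  omega

/-- **The estimate transfers to any relabelling**: if `TransducerMoebiusEstimateSync` holds at `M`
for every `π`, then the relabelled estimate holds at `M` for every `π'` (uniformly: the finitely
many thresholds are maximised; the relabelled condition for `π'` on the class of `m` is the original
condition for `ρ_M ≫ π' ≫ ρ_{S(m)}⁻¹`). [cite: Mullner2017, Prop. 2.6] -/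
theorem TransducerMoebiusEstimateSync.relabel {k : ℕ} (hk : 2 ≤ k) {δ' : σ' → ℕ → σ'}
    {M : MinImage δ'} {l1 l2 : ℕ} (h : ∀ π, TransducerMoebiusEstimateSync k δ' M π l1 l2)
    (ρ : MinImage δ' → Equiv.Perm (Fin (minRank δ'))) (π' : Equiv.Perm (Fin (minRank δ'))) :
    TransducerMoebiusEstimateSyncρ k δ' ρ M π' l1 l2 := by
  have hk1 : 1 < k := hk
  intro ε hε
  choose N₀ hN₀ using fun π => h π ε hε
  refine ⟨max (univ.sup N₀) (k ^ (l1 + l2)), fun N hN b m hsync => ?_⟩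
  obtain ⟨w₀, hw₀, hm⟩ := hsync
  have hL : l2 ≤ (Nat.digits k N).length - l1 :=
    le_length_digits_sub hk1 ((le_max_right _ _).trans hN)
  set π := ((ρ M).trans π').trans (ρ (M.next (w₀ ++ msbBlock k l2 m))).symm with hπ
  have hfilter : ((range (N + 1)).filter fun n =>
        n / k ^ ((Nat.digits k N).length - l1) = b ∧ n % k ^ l2 = m ∧
          M.Tρ ρ (msbBlock k ((Nat.digits k N).length - l1)
            (n % k ^ ((Nat.digits k N).length - l1))) = π') =
      ((range (N + 1)).filter fun n =>
        n / k ^ ((Nat.digits k N).length - l1) = b ∧ n % k ^ l2 = m ∧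
          M.T (msbBlock k ((Nat.digits k N).length - l1)
            (n % k ^ ((Nat.digits k N).length - l1))) = π) := by
    refine filter_congr fun n _ => ?_
    constructor
    · rintro ⟨h1, h2, h3⟩
      exact ⟨h1, h2, (Tρ_msbBlock_eq_iff hk1 ρ M hw₀ hm h2 hL π').1 h3⟩
    · rintro ⟨h1, h2, h3⟩
      exact ⟨h1, h2, (Tρ_msbBlock_eq_iff hk1 ρ M hw₀ hm h2 hL π').2 h3⟩
  rw [hfilter]
  exact hN₀ π N ((le_sup (f := N₀) (mem_univ π)).trans ((le_max_left _ _).trans hN)) b m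
    ⟨w₀, hw₀, hm⟩

/-- **… and back**: the relabelled estimate at `M` for every `π'` gives the original estimate at `M`
for every `π`. [cite: Mullner2017, Prop. 2.6] -/
theorem TransducerMoebiusEstimateSyncρ.unlabel {k : ℕ} (hk : 2 ≤ k) {δ' : σ' → ℕ → σ'}
    {ρ : MinImage δ' → Equiv.Perm (Fin (minRank δ'))} {M : MinImage δ'} {l1 l2 : ℕ}
    (h : ∀ π', TransducerMoebiusEstimateSyncρ k δ' ρ M π' l1 l2)
    (π : Equiv.Perm (Fin (minRank δ'))) : TransducerMoebiusEstimateSync k δ' M π l1 l2 := by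
  have hk1 : 1 < k := hk
  intro ε hε
  choose N₀ hN₀ using fun π' => h π' ε hε
  refine ⟨max (univ.sup N₀) (k ^ (l1 + l2)), fun N hN b m hsync => ?_⟩
  obtain ⟨w₀, hw₀, hm⟩ := hsync
  have hL : l2 ≤ (Nat.digits k N).length - l1 :=
    le_length_digits_sub hk1 ((le_max_right _ _).trans hN)
  set S := M.next (w₀ ++ msbBlock k l2 m) with hS
  set π' := ((ρ M).symm.trans π).trans (ρ S) with hπ'
  have hback : ((ρ M).trans π').trans (ρ S).symm = π := by
    rw [hπ']
    ext i
    simp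
  have hfilter : ((range (N + 1)).filter fun n =>
        n / k ^ ((Nat.digits k N).length - l1) = b ∧ n % k ^ l2 = m ∧
          M.T (msbBlock k ((Nat.digits k N).length - l1)
            (n % k ^ ((Nat.digits k N).length - l1))) = π) =
      ((range (N + 1)).filter fun n =>
        n / k ^ ((Nat.digits k N).length - l1) = b ∧ n % k ^ l2 = m ∧
          M.Tρ ρ (msbBlock k ((Nat.digits k N).length - l1)
            (n % k ^ ((Nat.digits k N).length - l1))) = π') := by
    refine filter_congr fun n _ => ?_
    constructor
    · rintro ⟨h1, h2, h3⟩
      refine ⟨h1, h2, (Tρ_msbBlock_eq_iff hk1 ρ M hw₀ hm h2 hL π').2 ?_⟩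
      rw [← hS, hback]; exact h3
    · rintro ⟨h1, h2, h3⟩
      refine ⟨h1, h2, ?_⟩
      have := (Tρ_msbBlock_eq_iff hk1 ρ M hw₀ hm h2 hL π').1 h3
      rwa [← hS, hback] at this
  rw [hfilter]
  exact hN₀ π' N ((le_sup (f := N₀) (mem_univ π')).trans ((le_max_left _ _).trans hN)) b m
    ⟨w₀, hw₀, hm⟩

/-- **Müllner 2017, Prop. 3.3 with the hypothesis in relabelled form**: if for every `k ≥ 2` and
every strongly connected base-`k` automaton (letters `≥ k` acting trivially) SOME relabelling `ρ` of
its naturally induced transducer satisfies Prop. 3.2 on synchronized residues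
(`TransducerMoebiusEstimateSyncρ`, e.g. the good labelling of Lemma 2.14 with all outputs in one
group), then `mullner_moebius_automatic`. [cite: Mullner2017, Prop. 3.3] -/
theorem mullner_moebius_automatic_of_transducerEstimateρ
    (H : ∀ (k : ℕ), 2 ≤ k → ∀ (σ' : Type) [Fintype σ'] [DecidableEq σ'] (δ' : σ' → ℕ → σ'),
      IsStronglyConnected δ' → (∀ q d, k ≤ d → δ' q d = q) →
      ∃ ρ : MinImage δ' → Equiv.Perm (Fin (minRank δ')),
        ∀ (M : MinImage δ') (π : Equiv.Perm (Fin (minRank δ'))) (l1 l2 : ℕ),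
          TransducerMoebiusEstimateSyncρ k δ' ρ M π l1 l2) :
    mullner_moebius_automatic := by
  refine mullner_moebius_automatic_of_transducerEstimate fun k hk σ' _ _ δ' hsc htriv M π l1 l2 => ?_
  obtain ⟨ρ, hρ⟩ := H k hk σ' δ' hsc htriv
  exact TransducerMoebiusEstimateSyncρ.unlabel hk (fun π' => hρ M π' l1 l2) π

end Transfer

end Literature.NumberTheory.LFunctions
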